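import Summits.Ventures.PercRepro.RankLevelSetH
import Summits.Ventures.PercRepro.PerLineClosingB

/-!
# PercRepro — C-025 Theorem N, Step 2 in the spelling of `C025`: `(p, 2)` on every simple matroid with
`ρ(E) ≥ p ≥ 4`, coloop-free when `ρ(E) = p` (p2, gen 5)

`PerLineClosing.lean` proves `Φ(p, 2)·#U′ ≤ #Y′` on finsets (`ThmN.phiTwo_mul_card_Up_le'`, with typer-2's
`D_lemma`).  Here it is restated with the set-builders of `C025` at `q = 2`: **`c025_two_of_simple`**.  Together with
p3's Theorem F (parallel pairs), the loop halving and typer-2's Lemma J₂ (coloops) this is the last piece of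
mine-2's Theorem N (`MINE2-RLS.md` §14–§15): C-025 for `q = 2` on every matroid.
-/

namespace PercRepro

open Finset

namespace ThmN

open ThmH

variable {α : Type*} [DecidableEq α] {M : Matroid α} [M.Finite]

/-- `phiK p 2 = phiTwo p` (definitionally). -/
theorem phiK_two_eq (p : ℕ) : phiK p 2 = BinomialLayer.phiTwo p := rfl

/-- The `U(p, 2)` set-builder of `C025` is at most `#U′` (complementation `A ↦ E ∖ A`). -/
theorem ncard_U_le_card_Up (M : Matroid α) [M.Finite] (p : ℕ) :
    {A : Set α | A ⊆ M.E ∧ M.eRk A = ((p : ℕ) : ℕ∞) ∧ M.eRk (M.E \ A) = ((2 : ℕ) : ℕ∞)}.ncard ≤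
      (Up M p).card := by
  rw [ncard_family_eq_card M (fun A => M.eRk A = ((p : ℕ) : ℕ∞) ∧ M.eRk (M.E \ A) = ((2 : ℕ) : ℕ∞))]
  refine Finset.card_le_card_of_injOn (fun A => gr M \ A) ?_ ?_
  · intro A hA
    simp only [Finset.mem_coe, Finset.mem_filter, Finset.mem_powerset] at hA
    obtain ⟨hAE, hAp, hA2⟩ := hA
    simp only [Finset.mem_coe, Up, Finset.mem_filter, Finset.mem_powerset]
    refine ⟨Finset.sdiff_subset, ?_, ?_⟩
    · rw [Finset.coe_sdiff, coe_gr]; exact hA2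
    · rw [Finset.sdiff_sdiff_eq_self hAE, hAp]
  · intro A hA A' hA' h
    simp only [Finset.mem_coe, Finset.mem_filter, Finset.mem_powerset] at hA hA'
    simp only at h
    rw [← Finset.sdiff_sdiff_eq_self hA.1, ← Finset.sdiff_sdiff_eq_self hA'.1, h]

omit [DecidableEq α] in
/-- The `Y(p, 2)` set-builder of `C025` counts `Yp M p`. -/
theorem ncard_Y_eq_card_Yp (M : Matroid α) [M.Finite] (p : ℕ) :
    {A : Set α | A ⊆ M.E ∧ ((2 : ℕ) : ℕ∞) < M.eRk A ∧ M.eRk A < ((p : ℕ) : ℕ∞)}.ncard = (Yp M p).card := by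
  rw [ncard_family_eq_card M (fun A => ((2 : ℕ) : ℕ∞) < M.eRk A ∧ M.eRk A < ((p : ℕ) : ℕ∞))]
  unfold Yp
  congr 1

end ThmN

open ThmN ThmH in
/-- **C-025 at `q = 2` on every simple matroid with `ρ(E) ≥ p ≥ 4`, coloop-free when `ρ(E) = p`** (mine-2 Theorem N
Step 2, `MINE2-RLS.md` §14 / §15.2): `phiK p 2 · #{A ⊆ E : ρ(A) = p, ρ(E ∖ A) = 2} ≤ #{A ⊆ E : 2 < ρ(A) < p}` — the
body of `C025` at `q = 2`. -/
theorem c025_two_of_simple {α : Type*} (M : Matroid α) [M.Finite] (p : ℕ) (hp4 : 4 ≤ p)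
    (hs : ∀ e ∈ M.E, ∀ f ∈ M.E, e ≠ f → M.eRk {e, f} = 2) (hpE : ((p : ℕ) : ℕ∞) ≤ M.eRank)
    (hcol : M.eRank = (p : ℕ) → ∀ e, ¬ M.IsColoop e) :
    phiK p 2 * ({A : Set α | A ⊆ M.E ∧ M.eRk A = ((p : ℕ) : ℕ∞) ∧ M.eRk (M.E \ A) = ((2 : ℕ) : ℕ∞)}.ncard : ℚ) ≤
      ({A : Set α | A ⊆ M.E ∧ ((2 : ℕ) : ℕ∞) < M.eRk A ∧ M.eRk A < ((p : ℕ) : ℕ∞)}.ncard : ℚ) := by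
  classical
  rw [ncard_Y_eq_card_Yp, phiK_two_eq]
  have h1 := ncard_U_le_card_Up M p
  have h2 := phiTwo_mul_card_Up_le' (M := M) hs hp4 hpE hcol
  have h1' : ({A : Set α | A ⊆ M.E ∧ M.eRk A = ((p : ℕ) : ℕ∞) ∧ M.eRk (M.E \ A) = ((2 : ℕ) : ℕ∞)}.ncard : ℚ) ≤
      ((Up M p).card : ℚ) := by exact_mod_cast h1
  calc BinomialLayer.phiTwo p * _ ≤ BinomialLayer.phiTwo p * ((Up M p).card : ℚ) :=
        mul_le_mul_of_nonneg_left h1' (phiTwo_nonneg p)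
    _ ≤ _ := h2

end PercRepro
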